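import Summits.AtomisticToContinuum.HydrodynamicLimit.Theorems.AntiMazurCoboundariesCorrectorPressureDecayTangentBias
import Summits.AtomisticToContinuum.HydrodynamicLimit.Theorems.AntiMazurCoboundariesCorrectorPressureDecayTangentBiasOneBodyLimit
import Summits.AtomisticToContinuum.HydrodynamicLimit.Theorems.AntiMazurCoboundariesCorrectorPressureDecayTangentBiasCampbellBound

/-!
# Bias continuity along tangent states: `TangentBias` is a theorem (line `FirstLemma`, crux stmt-AtomisticToContinuum-14135)

The bridge statement `TangentBias` of the tangent frame (`…KiferTangent.lean`, p138873: along a tangent state `μ` of a tangent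
family the normalised one-body bias `(∫φ)⁻¹ σ³ (N+1)⁻¹ E_{Q k}[Σᵢ φ(qᵢ) g((vᵢ − u₀)/√θ)]` converges to the one-body fast bias per
unit volume `E_μ[Σ_{p ∈ ω, p.1 ∈ [0,1)³} g((p.2 − u₀)/√θ)]`), posited in cycle 2 as INFRASTRUCTURE, is now PROVED unconditionally:
the assembly `stub_tangentBiasOfFacts` (…TangentBias.lean, p143261, on the finite-`N` files …TangentBias{Torus,Cutoff,
VelocityTail,Window}.lean) applied to the two `N = ∞` facts of the frame, both landed by wave-3 stub-workers of lead a1: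
the ONE-BODY LIMIT `stub_oneBodyLimit` (…TangentBiasOneBodyLimit.lean, p142719: Laplace-functional convergence on `C_c⁺` +
the hard-core uniform bound ⇒ convergence of expectations of linear statistics) and the CAMPBELL BOUND `stub_campbellBound`
(…TangentBiasCampbellBound.lean, p142492: intensity bound of tangent states from the velocity-tail bound, by `C_c⁺` minorants,
the finite-`N` Campbell bound, monotone convergence and outer regularity). This closes the registered stub
`stub_tangentBias : TangentBias` of the line's skeleton.
-/

noncomputable section

namespace Summit.AtomisticToContinuum.HydrodynamicLimit.Theorems.KiferCompactification

/-- **`TangentBias` holds** (registered stub `stub_tangentBias` of line `FirstLemma`, CLOSED): bias continuity along tangent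
states, from the assembly `stub_tangentBiasOfFacts` and the landed one-body limit `stub_oneBodyLimit` and Campbell bound
`stub_campbellBound`. -/
theorem stub_tangentBias : TangentBias :=
  stub_tangentBiasOfFacts stub_oneBodyLimit stub_campbellBound

/-- `TangentBias` holds (alias of `stub_tangentBias` under the frame's naming scheme). -/
theorem tangentBias_holds : TangentBias :=
  stub_tangentBias

end Summit.AtomisticToContinuum.HydrodynamicLimit.Theorems.KiferCompactification

end
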